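import Literature.NumberTheory.EllipticCurves.DeligneSerreWeightOneIrreducibleFrobeniusProofs
import Literature.NumberTheory.GaloisRepresentations.KroneckerWeber
import Literature.NumberTheory.GaloisRepresentations.ModNCyclotomicCharacter
import Literature.NumberTheory.GaloisRepresentations.CyclotomicCharacterSurjectiveProofs
import Literature.NumberTheory.LFunctions.LOneTruncatedEulerProduct
import HarnessLib

/-!
# Deligne–Serre 1974, Thm. 4.1 (irreducibility) from the Kronecker–Weber theorem

A third sufficient input for the named fact
`Literature.NumberTheory.EllipticCurves.ModularForms.DeligneSerre1974.thm41_isIrreducible`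
(`NewformGaloisRepProofs`; Deligne–Serre 1974, Thm. 4.1, second assertion: the finite-image
representation `ρ : Gal(ℚ̄/ℚ) → GL₂(ℂ)` attached to a weight-one newform away from `N` is
irreducible). The tree proves it from the Chebotarev density theorem
(`thm41_isIrreducible_of`, `DeligneSerreWeightOneIrreducible`) and from (2.7.4)
(`thm41_isIrreducible_of_prop27_conj'`, `DeligneSerreWeightOneIrreducibleFrobeniusProofs`); here

* `thm41_isIrreducible_of_kroneckerWeber'` : `KroneckerWeber → thm41_isIrreducible`,

`Literature.NumberTheory.GaloisRepresentations.KroneckerWeber` being the named fact "every finite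
abelian extension of `ℚ` lies in a cyclotomic field" (Washington, Thm. 14.1). This is the route of
the printed proof (op. cit. 8.7): "celles-ci correspondraient à des caractères `χ₁` et `χ₂` …" is
class field theory over `ℚ`, i.e. Kronecker–Weber, and "[21], VI.4.2" is Dirichlet's
`L(1, χ) ≠ 0`, which Mathlib has.

## The argument

Suppose `ρ ≃ χ₁ ⊕ χ₂` (finite image), so `a_p = χ₁(F_p) + χ₂(F_p)` for `p ∤ N` and
`|a_p|² = 2 + 2 Re ψ(F_p)`, `ψ = χ₁χ₂⁻¹ : Γ_ℚ → ℂˣ` a character with open kernel.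

1. `exists_forall_smul_eq_self_imp_eq_one_of_isKroneckerWeber` (any field `K` with the
   Kronecker–Weber property, any commutative target): there is `m ≥ 1` with `ψ(σ) = 1` whenever
   `σ` fixes the `m`-th roots of unity — the fixed field of `ker ψ` is finite abelian Galois,
   hence inside `K(μ_m)` (same argument as `ZpExtension.exists_forall_smul_eq_self_imp_dvd`).
2. `exists_dirichletCharacter_of_kroneckerWeber` (`K = ℚ`): `ψ` factors through the mod `m`
   cyclotomic character `Γ_ℚ → (ℤ/mℤ)ˣ` (surjective: `modNCyclotomicCharacter_rat_surjective`,
   irreducibility of `Φ_m`), giving a Dirichlet character `χ` mod `m` with `ψ(Frob_𝔓) = χ(p)`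
   for `p ∤ m` (`χ_m(Frob_p) = p`, `modNCyclotomicCharacter_eq_residueCard_of_isArithFrobAt`).
3. So `|a_p|² = 2 + 2 Re χ(p)` for `p ∤ Nm`. If `χ = 1` this is `4` and
   `∑_{p ∤ Nm} 4 p^{-s} ∼ 4 log (1/(s-1))` contradicts Rankin's bound (5.1.1) (`prop51_holds`).
4. If `χ ≠ 1`: `∑_p Re χ(p) p^{-s} ≥ log |L(s, χ)| - 2` for `s > 1`
   (`DirichletLOne.log_norm_LFunction_le_tsum_re`, the Euler product) and `L(s, χ) → L(1, χ) ≠ 0`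
   (Mathlib `DirichletCharacter.LFunction_ne_zero_of_one_le_re`), so the twisted prime sum is
   bounded below near `s = 1` (`DirichletLOne.exists_eventually_le_tsum_re`: the one-sided half
   of "`∑_p χ(p) p^{-s} = O(1)`", which is all §8.7 needs); hence
   `∑_{p∤N} |a_p|² p^{-s} ≥ 2 ∑_{p ∤ Nm} p^{-s} - O(1) ∼ 2 log (1/(s-1))`, again contradicting
   (5.1.1).

## References

* P. Deligne, J.-P. Serre, *Formes modulaires de poids 1*, Ann. Sci. ÉNS (4) 7 (1974), Thm. 4.1,
  Prop. 5.1, §8.7. [DeligneSerreASENS1974]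
* L. C. Washington, *Introduction to Cyclotomic Fields*, 2nd ed., GTM 83 (1997), Thm. 2.5,
  Thm. 14.1. [Washington1997]
* J.-P. Serre, *Cours d'arithmétique*, PUF (1970), Ch. VI, Prop. 4.2 ("[21], VI.4.2").

## Design notes

* No new named fact (D-0026); the only hypothesis of the main theorem is the existing named fact
  `KroneckerWeber`.
* The sets of primes `U = {p ∤ Nm}` and `Bad = {p ∣ N or p ∣ m}` are introduced as opaque sets
  with a membership lemma, so that all `if p.Prime ∧ p ∈ U then …` carry the same decidability
  instances as the tree's `LFunctions.PrimeSum` lemmas and `HasDirichletDensity`.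
-/

noncomputable section

open Filter Topology NumberField IsDedekindDomain Rat.HeightOneSpectrum

namespace Literature.NumberTheory.GaloisRepresentations

open Field Polynomial

/-! ### Kronecker–Weber: finite-order characters of `Γ_K` are cyclotomic -/

section KroneckerWeber

universe u

variable {K : Type u} [Field K] [CharZero K]

/-- **Kronecker–Weber ⇒ characters with open kernel are trivial on `Gal(K̄/K(μ_m))`.** Let `K`
have the Kronecker–Weber property and let `ψ : Γ_K → M` be a homomorphism to a commutative group
with open kernel. Then there is `m ≥ 1` such that every `σ ∈ Γ_K` fixing the `m`-th roots of
unity of `K̄` lies in `ker ψ`: the fixed field `L = K̄^{ker ψ}` is a finite abelian Galois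
extension of `K`, so `L ⊆ K(μ_m)` by Kronecker–Weber, and `σ` fixing `μ_m` fixes `L`.
(Same argument as `EllipticCurves.ZpExtension.exists_forall_smul_eq_self_imp_dvd`.)
Ref: Washington, *Introduction to Cyclotomic Fields*, Thm. 14.1. [folklore] -/
theorem exists_forall_smul_eq_self_imp_eq_one_of_isKroneckerWeber (hKW : IsKroneckerWeber K)
    {M : Type*} [CommGroup M] (ψ : absoluteGaloisGroup K →* M)
    (hker : IsOpen ((ψ.ker : Subgroup (absoluteGaloisGroup K)) : Set (absoluteGaloisGroup K))) :
    ∃ m : ℕ, 0 < m ∧ ∀ σ : absoluteGaloisGroup K,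
      (∀ ζ : AlgebraicClosure K, ζ ^ m = 1 → σ • ζ = ζ) → ψ σ = 1 := by
  classical
  set U : Subgroup (absoluteGaloisGroup K) := ψ.ker with hUdef
  haveI hUnormal : U.Normal := MonoidHom.normal_ker ψ
  -- transported to `K̄ ≃ₐ[K] K̄` along the identity
  let U' : Subgroup (AlgebraicClosure K ≃ₐ[K] AlgebraicClosure K) :=
    U.map (absoluteGaloisGroup.toAlgEquiv K).toMonoidHom
  have hU'open : IsOpen (U' : Set (AlgebraicClosure K ≃ₐ[K] AlgebraicClosure K)) := by
    have hHeq : (U' : Set (AlgebraicClosure K ≃ₐ[K] AlgebraicClosure K)) =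
        (absoluteGaloisGroup.toAlgEquiv K).symm ⁻¹' U := by
      ext f
      rw [SetLike.mem_coe, Set.mem_preimage, SetLike.mem_coe]
      exact Subgroup.mem_map_equiv
    have hcont : Continuous (absoluteGaloisGroup.toAlgEquiv K).symm := continuous_id
    rw [hHeq]
    exact hker.preimage hcont
  have hU'closed : IsClosed (U' : Set (AlgebraicClosure K ≃ₐ[K] AlgebraicClosure K)) :=
    Subgroup.isClosed_of_isOpen _ hU'open
  have hU'normal : U'.Normal := hUnormal.map _ (absoluteGaloisGroup.toAlgEquiv K).surjective
  -- the fixed field `L = K̄^U`, finite abelian Galois over `K`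
  let L : IntermediateField K (AlgebraicClosure K) := IntermediateField.fixedField U'
  have hfix : L.fixingSubgroup = U' :=
    InfiniteGalois.fixingSubgroup_fixedField (⟨U', hU'closed⟩ : ClosedSubgroup _)
  haveI : FiniteDimensional K L :=
    (InfiniteGalois.isOpen_iff_finite L).mp (by rw [hfix]; exact hU'open)
  haveI : IsGalois K L := (InfiniteGalois.normal_iff_isGalois L).mp (by rw [hfix]; exact hU'normal)
  have hcomm : ∀ f g : L ≃ₐ[K] L, f * g = g * f := by
    intro f g
    obtain ⟨σ', rfl⟩ := AlgEquiv.restrictNormalHom_surjective (AlgebraicClosure K) f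
    obtain ⟨τ', rfl⟩ := AlgEquiv.restrictNormalHom_surjective (AlgebraicClosure K) g
    set ρ' : AlgebraicClosure K ≃ₐ[K] AlgebraicClosure K := σ' * τ' * σ'⁻¹ * τ'⁻¹ with hρ'
    have hmem : ρ' ∈ U' := by
      refine ⟨(absoluteGaloisGroup.toAlgEquiv K).symm ρ', ?_, ?_⟩
      · rw [SetLike.mem_coe, hUdef, MonoidHom.mem_ker, hρ', map_mul, map_mul, map_mul, map_inv,
          map_inv, map_mul, map_mul, map_mul, map_inv, map_inv,
          mul_comm (ψ _) (ψ ((absoluteGaloisGroup.toAlgEquiv K).symm τ')), mul_inv_cancel_right,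
          mul_inv_cancel]
      · exact (absoluteGaloisGroup.toAlgEquiv K).apply_symm_apply _
    have hone : AlgEquiv.restrictNormalHom L ρ' = 1 := by
      ext x
      rw [AlgEquiv.one_apply]
      have hx : ρ' (x : AlgebraicClosure K) = x :=
        (IntermediateField.mem_fixedField_iff U' (x : AlgebraicClosure K)).mp x.2 _ hmem
      have hcommutes := AlgEquiv.restrictNormal_commutes ρ' L x
      change ((ρ'.restrictNormal L x : L) : AlgebraicClosure K) = ρ' (x : AlgebraicClosure K)
        at hcommutes
      rw [hx] at hcommutes
      exact hcommutes
    rw [hρ', map_mul, map_mul, map_mul, map_inv, map_inv, mul_inv_eq_one, mul_inv_eq_iff_eq_mul]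
      at hone
    exact hone
  haveI : IsMulCommutative (L ≃ₐ[K] L) := ⟨⟨hcomm⟩⟩
  haveI : IsAbelianGalois K L := IsAbelianGalois.mk
  -- Kronecker–Weber
  obtain ⟨m, hm0, hLm⟩ := hKW L inferInstance inferInstance
  refine ⟨m, hm0, fun σ hσ => ?_⟩
  rw [← MonoidHom.mem_ker, ← hUdef]
  have hσL : absoluteGaloisGroup.toAlgEquiv K σ ∈ L.fixingSubgroup := by
    rw [IntermediateField.mem_fixingSubgroup_iff]
    intro x hx
    exact (IntermediateField.forall_mem_adjoin_smul_eq_self_iff (F := K)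
      (S := {ζ : AlgebraicClosure K | ζ ^ m = 1}) σ).mpr (fun ζ hζ => hσ ζ hζ) x (hLm hx)
  rw [hfix] at hσL
  obtain ⟨ρ, hρU, hρσ⟩ := Subgroup.mem_map.mp hσL
  have hρ : ρ = σ := (absoluteGaloisGroup.toAlgEquiv K).injective hρσ
  rw [← hρ]
  exact hρU

end KroneckerWeber

/-! ### Over `ℚ`: the character is a Dirichlet character at Frobenius elements -/

section Rat

/-- The mod `m` cyclotomic character of `Γ_ℚ` is surjective (`Gal(ℚ(ζ_m)/ℚ) ≃ (ℤ/mℤ)ˣ`,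
irreducibility of `Φ_m` over `ℚ`; tree `RootOfUnityAction.exists_smul_eq_pow_and_smul_eq_self`).
Ref: Washington, *Introduction to Cyclotomic Fields*, Thm. 2.5. [folklore] -/
theorem modNCyclotomicCharacter_rat_surjective (m : ℕ) [NeZero m] :
    Function.Surjective (modNCyclotomicCharacter ℚ m) := by
  intro a
  obtain ⟨σ, hσ, -⟩ := RootOfUnityAction.exists_smul_eq_pow_and_smul_eq_self (K := ℚ) (A := m)
    (B := 1) (Nat.coprime_one_right m)
    (by rw [mul_one]; exact cyclotomic.irreducible_rat (NeZero.pos m)) a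
  obtain ⟨ζ, hζ⟩ := HasEnoughRootsOfUnity.exists_primitiveRoot (AlgebraicClosure ℚ) m
  refine ⟨σ, Units.ext ?_⟩
  rw [modNCyclotomicCharacter_eq_of_smul_eq_pow ℚ m hζ σ (hσ ζ hζ.pow_eq_one),
    ZMod.natCast_zmod_val]

/-- **Kronecker–Weber ⇒ a character of `Γ_ℚ` with open kernel is a Dirichlet character at the
Frobenius elements**: for `ψ : Γ_ℚ → ℂˣ` with open kernel there are `m ≥ 1` and a Dirichlet
character `χ` modulo `m` such that `ψ(Frob_𝔓) = χ(p)` for every prime `p ∤ m`, every prime `𝔓`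
of `\bar ℤ` above `p` and every arithmetic Frobenius `Frob_𝔓` (`ψ` factors through
`Gal(ℚ(μ_m)/ℚ) ≃ (ℤ/mℤ)ˣ` by Kronecker–Weber, and `Frob_p ↦ p`). This is the input
"χ₁, χ₂ … correspondraient à des caractères [de Dirichlet]" of Deligne–Serre 1974, 8.7 (there
from class field theory). Ref: Washington, *Introduction to Cyclotomic Fields*, Thm. 14.1;
Neukirch, *Algebraic Number Theory*, VII §5, proof of (5.6). [folklore] -/
theorem exists_dirichletCharacter_of_kroneckerWeber (hKW : KroneckerWeber)
    (ψ : absoluteGaloisGroup ℚ →* ℂˣ)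
    (hker : IsOpen ((ψ.ker : Subgroup (absoluteGaloisGroup ℚ)) : Set (absoluteGaloisGroup ℚ))) :
    ∃ (m : ℕ) (_ : NeZero m) (χ : DirichletCharacter ℂ m),
      ∀ (p : ℕ) (hp : p.Prime), ¬ p ∣ m →
        ∀ 𝔓 ∈ (primesEquiv.symm ⟨p, hp⟩ : HeightOneSpectrum (𝓞 ℚ)).primesAbove,
          ∀ σ : absoluteGaloisGroup ℚ, IsArithFrobAt (𝓞 ℚ) σ 𝔓 → (ψ σ : ℂ) = χ (p : ZMod m) := by
  classical
  obtain ⟨m, hm, hfixm⟩ := exists_forall_smul_eq_self_imp_eq_one_of_isKroneckerWeber hKW ψ hker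
  haveI : NeZero m := ⟨hm.ne'⟩
  set c : absoluteGaloisGroup ℚ →* (ZMod m)ˣ := modNCyclotomicCharacter ℚ m with hcdef
  -- `ker c ≤ ker ψ`
  have hle : c.ker ≤ ψ.ker := by
    intro σ hσ
    rw [MonoidHom.mem_ker] at hσ ⊢
    refine hfixm σ fun ζ hζ => ?_
    rw [modNCyclotomicCharacter_spec ℚ m σ ζ hζ, ← hcdef, hσ, Units.val_one]
    rcases Nat.lt_or_ge 1 m with h1 | h1
    · rw [ZMod.val_one'' h1.ne', pow_one]
    · have hm1 : m = 1 := le_antisymm h1 hm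
      subst hm1
      rw [pow_one] at hζ
      rw [hζ, one_pow]
  -- factor `ψ = χ₀ ∘ c`
  have hsurj : Function.Surjective c := modNCyclotomicCharacter_rat_surjective m
  have hs : Function.RightInverse (Function.surjInv hsurj) c := Function.rightInverse_surjInv hsurj
  set χ₀ : (ZMod m)ˣ →* ℂˣ := MonoidHom.liftOfRightInverse c (Function.surjInv hsurj) hs ⟨ψ, hle⟩
    with hχ₀
  have hχ₀c : ∀ σ, χ₀ (c σ) = ψ σ := fun σ =>
    MonoidHom.liftOfRightInverse_comp_apply c (Function.surjInv hsurj) hs ⟨ψ, hle⟩ σ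
  refine ⟨m, inferInstance, MulChar.ofUnitHom χ₀, fun p hp hpm 𝔓 h𝔓 σ hσ => ?_⟩
  set v : HeightOneSpectrum (𝓞 ℚ) := primesEquiv.symm ⟨p, hp⟩ with hvdef
  have hvp : ((primesEquiv v : Nat.Primes) : ℕ) = p := by rw [hvdef, Equiv.apply_symm_apply]
  have hN : (m : absIntegers (𝓞 ℚ) ℚ) ∉ 𝔓 :=
    Rat.natCast_not_mem_of_mem_primesAbove_of_not_dvd h𝔓 (by rw [hvp]; exact hpm)
  have hc : (c σ : ZMod m) = (p : ZMod m) := by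
    rw [hcdef, modNCyclotomicCharacter_eq_residueCard_of_isArithFrobAt h𝔓 hN hσ,
      HeightOneSpectrum.residueCard, LFunctions.absNorm_asIdeal_eq_primesEquiv, hvp]
  rw [← hc, MulChar.ofUnitHom_coe, hχ₀c]

end Rat

end Literature.NumberTheory.GaloisRepresentations

/-! ### A one-sided bound for `∑_p Re χ(p) p^{-σ}` near `σ = 1` -/

namespace Literature.NumberTheory.LFunctions.DirichletLOne

/-- **`∑_p Re χ(p) p^{-σ}` is bounded below as `σ → 1⁺`** for a non-principal Dirichlet character
`χ`: `∑_p Re χ(p) p^{-σ} ≥ log |L(σ, χ)| − 2` (`log_norm_LFunction_le_tsum_re`) and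
`L(σ, χ) → L(1, χ) ≠ 0`. This one-sided form of "`∑_p χ(p) p^{-s} = O(1)`" (Serre, *Cours
d'arithmétique*, VI.4.2) is what Deligne–Serre 1974, 8.7 uses. [folklore] -/
theorem exists_eventually_le_tsum_re {q : ℕ} [NeZero q] (χ : DirichletCharacter ℂ q) (hχ : χ ≠ 1) :
    ∃ B : ℝ, ∀ᶠ σ : ℝ in 𝓝[>] (1 : ℝ),
      B ≤ ∑' p : Nat.Primes, (χ p * (p : ℂ) ^ (-(σ : ℂ))).re := by
  have hne : χ.LFunction 1 ≠ 0 :=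
    DirichletCharacter.LFunction_ne_zero_of_one_le_re χ (Or.inl hχ) (by simp)
  have hcont : ContinuousAt (fun σ : ℝ => Real.log ‖χ.LFunction (σ : ℂ)‖) 1 := by
    have h1 : ContinuousAt (fun σ : ℝ => χ.LFunction (σ : ℂ)) 1 :=
      ((DirichletCharacter.differentiable_LFunction hχ).continuous.continuousAt).comp
        Complex.continuous_ofReal.continuousAt
    have h2 : ContinuousAt (fun σ : ℝ => ‖χ.LFunction (σ : ℂ)‖) 1 := h1.norm
    refine (Real.continuousAt_log ?_).comp h2
    simpa using hne
  have hev : ∀ᶠ σ : ℝ in 𝓝 (1 : ℝ),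
      Real.log ‖χ.LFunction 1‖ - 1 < Real.log ‖χ.LFunction (σ : ℂ)‖ := by
    have := hcont.eventually (lt_mem_nhds (a := Real.log ‖χ.LFunction 1‖ - 1) (by simp))
    simpa using this
  refine ⟨Real.log ‖χ.LFunction 1‖ - 3, ?_⟩
  filter_upwards [nhdsWithin_le_nhds hev, self_mem_nhdsWithin] with σ hσ hσ1
  have h := log_norm_LFunction_le_tsum_re χ (show (1 : ℝ) < σ from hσ1)
  linarith

end Literature.NumberTheory.LFunctions.DirichletLOne

/-! ### Thm. 4.1 (irreducibility) from Kronecker–Weber, Prop. 5.1 and `L(1, χ) ≠ 0` -/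

namespace Literature.NumberTheory.EllipticCurves.ModularForms.DeligneSerre1974

section Irreducible

open scoped MatrixGroups NumberField
open CongruenceSubgroup Field Polynomial IsDedekindDomain Rat.HeightOneSpectrum
  Literature.NumberTheory.GaloisRepresentations

variable {N : ℕ} [NeZero N]

open Classical in
/-- Real part of `χ(p) p^{-s}` for real `s`. [folklore] -/
theorem re_mul_natCast_cpow_neg {q : ℕ} (χ : DirichletCharacter ℂ q) (p : ℕ) (s : ℝ) :
    (χ p * (p : ℂ) ^ (-(s : ℂ))).re = (χ (p : ZMod q)).re * (p : ℝ) ^ (-s) := by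
  have h : (p : ℂ) ^ (-(s : ℂ)) = (((p : ℝ) ^ (-s) : ℝ) : ℂ) := by
    rw [Complex.ofReal_cpow (Nat.cast_nonneg p), Complex.ofReal_neg, Complex.ofReal_natCast]
  rw [h, mul_comm, Complex.re_ofReal_mul, mul_comm]

open Classical in
/-- The prime sum `∑_p Re χ(p) p^{-s}` as a sum over `ℕ`. [folklore] -/
theorem tsum_primes_re_eq_tsum_nat {q : ℕ} (χ : DirichletCharacter ℂ q) (s : ℝ) :
    ∑' p : Nat.Primes, (χ p * (p : ℂ) ^ (-(s : ℂ))).re =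
      ∑' p : ℕ, if p.Prime then (χ (p : ZMod q)).re * (p : ℝ) ^ (-s) else 0 := by
  simp_rw [re_mul_natCast_cpow_neg]
  change ∑' p : (setOf Nat.Prime : Set ℕ), (χ ((p : ℕ) : ZMod q)).re * ((p : ℕ) : ℝ) ^ (-s) = _
  rw [tsum_subtype (setOf Nat.Prime) fun p : ℕ => (χ (p : ZMod q)).re * (p : ℝ) ^ (-s)]
  refine tsum_congr fun p => ?_
  simp only [Set.indicator_apply, Set.mem_setOf_eq]

/-- Summability of the twisted indicator prime sums `∑_{p ∈ X} Re χ(p) p^{-s}`, `s > 1`.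
[folklore] -/
theorem summable_re_mul_indicator {q : ℕ} (χ : DirichletCharacter ℂ q) (X : Set ℕ)
    [∀ p : ℕ, Decidable (p.Prime ∧ p ∈ X)] {s : ℝ} (hs : 1 < s) :
    Summable fun p : ℕ => if p.Prime ∧ p ∈ X then (χ (p : ZMod q)).re * (p : ℝ) ^ (-s) else 0 := by
  refine Summable.of_norm_bounded (LFunctions.PrimeSum.summable X hs) fun p => ?_
  split_ifs with h
  · rw [Real.norm_eq_abs, abs_mul, abs_of_nonneg (Real.rpow_nonneg (Nat.cast_nonneg _) _)]
    refine mul_le_of_le_one_left (Real.rpow_nonneg (Nat.cast_nonneg _) _) ?_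
    exact (Complex.abs_re_le_norm _).trans (DirichletCharacter.norm_le_one χ _)
  · simp

open Classical in
/-- **Deligne–Serre 1974, Thm. 4.1 (irreducibility) from the Kronecker–Weber theorem** (in place
of the class field theory / Chebotarev input of the printed §8.7). For a newform
`f ∈ S_1(Γ₁(N))`, every finite-image representation `ρ : Gal(ℚ̄/ℚ) → GL₂(ℂ)` attached to `f` away
from `N` is irreducible: if `ρ = χ₁ ⊕ χ₂`, the character `ψ = χ₁χ₂⁻¹` has open kernel, so by
Kronecker–Weber `ψ(F_p) = χ(p)` (`p ∤ m`) for a Dirichlet character `χ` mod `m`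
(`exists_dirichletCharacter_of_kroneckerWeber`), and `|a_p|² = 2 + 2 Re χ(p)` for `p ∤ Nm`.
If `χ = 1` then `|a_p|² = 4`; otherwise `∑_p Re χ(p) p^{-s} ≥ log |L(s, χ)| - 2` is bounded
below as `s → 1⁺` since `L(1, χ) ≠ 0` (`DirichletLOne.exists_eventually_le_tsum_re`; this is the
half of "[21], VI.4.2: `∑ χ(p) p^{-s} = O(1)`" that the argument needs). Either way
`∑_{p∤N} |a_p|² p^{-s} ≥ (2 - o(1)) log (1/(s-1))`, contradicting Rankin's bound (5.1.1)
(`prop51_holds`). [cite: DeligneSerreASENS1974, Thm. 4.1 and §8.7] -/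
theorem thm41_isIrreducible_of_kroneckerWeber (hKW : KroneckerWeber)
    (hneb : IsNewform1.mem_nebentypusSubspace_nebentypus (N := N) (k := 1))
    (heig : IsNewform1.heckeEigenvalue_eq_coeff (N := N) (k := 1)) :
    thm41_isIrreducible (N := N) := by
  intro f hf ρ hρ hfin
  by_contra hirr
  obtain ⟨χ₁, χ₂, htr, hker, hord, -⟩ := exists_characters_of_not_isIrreducible ρ hfin hirr
  haveI : Finite (ρ : absoluteGaloisGroup ℚ →* GL (Fin 2) ℂ).range :=
    Set.Finite.to_subtype (s := ((ρ : absoluteGaloisGroup ℚ →* GL (Fin 2) ℂ).range :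
      Set (GL (Fin 2) ℂ))) (by rw [MonoidHom.coe_range]; exact hfin)
  haveI : Inhabited (absoluteGaloisGroup ℚ) := ⟨1⟩
  set n := Nat.card (ρ : absoluteGaloisGroup ℚ →* GL (Fin 2) ℂ).range with hndef
  have hn : n ≠ 0 := Nat.card_pos.ne'
  have hnorm₁ : ∀ g, ‖χ₁ g‖ = 1 := fun g ↦ Complex.norm_eq_one_of_pow_eq_one (hord g).1 hn
  have hnorm₂ : ∀ g, ‖χ₂ g‖ = 1 := fun g ↦ Complex.norm_eq_one_of_pow_eq_one (hord g).2 hn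
  -- `ψ = χ₁ χ₂⁻¹`
  set ψ : absoluteGaloisGroup ℚ →* ℂˣ := χ₁.toHomUnits * (χ₂.toHomUnits)⁻¹ with hψdef
  have hψ : ∀ g, (ψ g : ℂ) = χ₁ g * (χ₂ g)⁻¹ := fun g ↦ by
    simp [hψdef]
  have hψker : ∀ g, ρ g = 1 → ψ g = 1 := fun g hg ↦ by
    ext; rw [hψ, (hker g hg).1, (hker g hg).2]; simp
  have hf0 : f ≠ 0 := ne_zero_of_isNormalized hf.2.2.2
  have heigen : ∀ p : ℕ, (hp : p.Prime) → ¬ p ∣ N →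
      ∃ a : ℂ, (haveI : NeZero p := ⟨hp.ne_zero⟩; heckeT (Gamma1 N) 1 p f) = a • f :=
    fun p hp _ ↦ hf.2.1 p hp
  -- (1) Frobenii: a choice `σ p` at each prime `p`
  have hvp : ∀ (p : ℕ) (hp : p.Prime),
      ((primesEquiv (primesEquiv.symm ⟨p, hp⟩ : HeightOneSpectrum (𝓞 ℚ)) : Nat.Primes) : ℕ)
        = p := fun p hp ↦ by simp
  choose 𝔓 h𝔓 using fun (p : ℕ) (hp : p.Prime) ↦
    HeightOneSpectrum.primesAbove_nonempty (primesEquiv.symm ⟨p, hp⟩ : HeightOneSpectrum (𝓞 ℚ))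
  choose σ hσ using fun (p : ℕ) (hp : p.Prime) ↦
    HeightOneSpectrum.exists_isArithFrobAt_of_mem_primesAbove_holds (h𝔓 p hp)
  -- (2) `a_p = χ₁(F_p) + χ₂(F_p)` for `p ∤ N`
  have hap : ∀ (p : ℕ) (hp : p.Prime), ¬ p ∣ N →
      heckeEigenvalue f p = χ₁ (σ p hp) + χ₂ (σ p hp) := by
    intro p hp hpN
    have hv : ((primesEquiv (primesEquiv.symm ⟨p, hp⟩ : HeightOneSpectrum (𝓞 ℚ)) :
        Nat.Primes) : ℕ) ∉ {q | q ∣ N} := by rw [hvp]; exact hpN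
    have hch := (hρ _ hv).2 _ (h𝔓 p hp) _ (hσ p hp)
    rw [hvp] at hch
    simp only [GaloisRepresentations.FramedRep.charpoly, map_heckePolynomial] at hch
    have htr' := trace_eq_of_charpoly_eq hch
    rw [htr, ← heig hf hp] at htr'
    exact htr'.symm
  -- (3) Kronecker–Weber: `ψ(F_p) = χ(p)` for a Dirichlet character `χ` mod `m`, `p ∤ m`
  have hψopen : IsOpen ((ψ.ker : Subgroup (absoluteGaloisGroup ℚ)) : Set (absoluteGaloisGroup ℚ)) := by
    have h1 : IsOpen (((ρ : absoluteGaloisGroup ℚ →* GL (Fin 2) ℂ).ker :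
        Subgroup (absoluteGaloisGroup ℚ)) : Set (absoluteGaloisGroup ℚ)) := by
      have : (((ρ : absoluteGaloisGroup ℚ →* GL (Fin 2) ℂ).ker :
          Subgroup (absoluteGaloisGroup ℚ)) : Set (absoluteGaloisGroup ℚ)) = ρ ⁻¹' {1} := by
        ext τ; simp [MonoidHom.mem_ker]
      rw [this]
      exact Literature.NumberTheory.GaloisRepresentations.DeligneSerre1974.isOpen_fiber_of_finite_range ρ.continuous hfin 1
    refine Subgroup.isOpen_mono (fun τ hτ ↦ ?_) h1
    rw [MonoidHom.mem_ker] at hτ ⊢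
    exact hψker τ hτ
  obtain ⟨m, _, χ, hχ⟩ := exists_dirichletCharacter_of_kroneckerWeber hKW ψ hψopen
  have hap2 : ∀ (p : ℕ) (hp : p.Prime), ¬ p ∣ N → ¬ p ∣ m →
      ‖heckeEigenvalue f p‖ ^ 2 = 2 + 2 * (χ (p : ZMod m)).re := by
    intro p hp hpN hpm
    rw [hap p hp hpN, norm_add_sq_of_norm_eq_one (hnorm₁ _) (hnorm₂ _), ← hψ,
      hχ p hp hpm _ (h𝔓 p hp) _ (hσ p hp)]
  -- (4) Rankin's bound for `f` and the good set of primes `U = {p ∤ Nm}`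
  obtain ⟨hsummf, C, hC⟩ := prop51_holds (nebentypus f) f (hneb hf) hf0 heigen
  simp only [Int.cast_one] at hsummf hC
  -- (the sets `U = {p ∤ Nm}` and `Bad = {p ∣ N or p ∣ m}` are kept opaque, so that all the
  -- `if p.Prime ∧ p ∈ U` below carry the same (classical) decidability instances)
  obtain ⟨U, hUmem⟩ : ∃ U : Set ℕ, ∀ p, p ∈ U ↔ ¬ p ∣ N ∧ ¬ p ∣ m := ⟨_, fun p ↦ Iff.rfl⟩
  obtain ⟨Bad, hBadmem⟩ : ∃ Bad : Set ℕ, ∀ p, p ∈ Bad ↔ p ∣ N ∨ p ∣ m := ⟨_, fun p ↦ Iff.rfl⟩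
  have hBadfin : Bad.Finite := by
    refine ((Set.finite_Iic N).union (Set.finite_Iic m)).subset ?_
    intro p hp
    rcases (hBadmem p).mp hp with hp | hp
    · exact Or.inl (Nat.le_of_dvd (Nat.pos_of_neZero N) hp)
    · exact Or.inr (Nat.le_of_dvd (Nat.pos_of_neZero m) hp)
  have hUBad : ∀ p : ℕ, p ∈ U ↔ p ∉ Bad := fun p ↦ by rw [hUmem, hBadmem, not_or]
  have hU : LFunctions.HasDirichletDensity U 1 := by
    refine hasDirichletDensity_of_finite (X := Set.univ) (T := Bad) hBadfin
      (fun p _ hp ↦ ?_) hasDirichletDensity_univ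
    simp only [Set.mem_univ, true_iff]
    exact (hUBad p).mpr hp
  have hrankin_ge : ∀ (s : ℝ) (p : ℕ), p.Prime → p ∈ U →
      rankinTerm f s p = ‖heckeEigenvalue f p‖ ^ 2 * (p : ℝ) ^ (-s) := by
    intro s p hp hpU
    simp [rankinTerm, hp, ((hUmem p).mp hpU).1]
  by_cases hχ1 : χ = 1
  · -- (5a) `χ = 1`: `|a_p|² = 4` on `U`, and `f` itself contradicts (5.1.1)
    have h4 : ∀ (p : ℕ) (hp : p.Prime), p ∈ U → ‖heckeEigenvalue f p‖ ^ 2 = 4 := by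
      intro p hp hpU
      have hunit : IsUnit (p : ZMod m) := (ZMod.isUnit_prime_iff_not_dvd hp).mpr ((hUmem p).mp hpU).2
      rw [hap2 p hp ((hUmem p).mp hpU).1 ((hUmem p).mp hpU).2, hχ1, MulChar.one_apply hunit,
        Complex.one_re]
      norm_num
    set T : ℝ → ℕ → ℝ := fun s p ↦
      if p.Prime ∧ p ∈ U then ‖heckeEigenvalue f p‖ ^ 2 * (p : ℝ) ^ (-s) else 0 with hTdef
    have hTle : ∀ s p, T s p ≤ rankinTerm f s p := by
      intro s p
      by_cases h : p.Prime ∧ p ∈ U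
      · simp only [hTdef, h, and_self, if_true]
        rw [hrankin_ge s p h.1 h.2]
      · simp only [hTdef, h, if_false]
        exact rankinTerm_nonneg f s p
    have hTnn : ∀ s p, 0 ≤ T s p := by
      intro s p
      simp only [hTdef]
      split_ifs <;> positivity
    refine false_of_rankin_bound_sum (T := T) (∅ : Finset ℕ) (fun _ ↦ 0) (fun _ ↦ ∅) (fun _ ↦ 0)
      (fun i hi ↦ absurd hi (Finset.notMem_empty i)) (by simp) U hU (J := 2) two_pos ?_ C ?_
    · intro s hs p
      simp only [Finset.sum_empty, mul_zero, add_zero]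
      by_cases h : p.Prime ∧ p ∈ U
      · simp only [hTdef, h, and_self, if_true, h4 p h.1 h.2]
        ring
      · simp only [hTdef, h, if_false]
        ring
    · filter_upwards [hC, LFunctions.PrimeSum.eventually_log_pos,
        LFunctions.PrimeSum.eventually_one_lt] with s hs hlog hs1
      have hle : ∑' p, T s p ≤ ∑' p, rankinTerm f s p :=
        Summable.tsum_le_tsum (hTle s) ((hsummf s hs1).of_nonneg_of_le (hTnn s) (hTle s))
          (hsummf s hs1)
      linarith
  · -- (5b) `χ ≠ 1`: `∑_p Re χ(p) p^{-s}` is bounded below near `s = 1`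
    obtain ⟨B, hB⟩ := LFunctions.DirichletLOne.exists_eventually_le_tsum_re χ hχ1
    set Lo : ℝ → ℕ → ℝ := fun s p ↦
      if p.Prime ∧ p ∈ U then (2 + 2 * (χ (p : ZMod m)).re) * (p : ℝ) ^ (-s) else 0 with hLo
    have hre1 : ∀ p : ℕ, |(χ (p : ZMod m)).re| ≤ 1 := fun p ↦
      (Complex.abs_re_le_norm _).trans (DirichletCharacter.norm_le_one χ _)
    have hLole : ∀ s p, Lo s p ≤ rankinTerm f s p := by
      intro s p
      by_cases h : p.Prime ∧ p ∈ U
      · simp only [hLo, h, and_self, if_true]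
        rw [hrankin_ge s p h.1 h.2, hap2 p h.1 ((hUmem p).mp h.2).1 ((hUmem p).mp h.2).2]
      · simp only [hLo, h, if_false]
        exact rankinTerm_nonneg f s p
    have hLonn : ∀ s p, 0 ≤ Lo s p := by
      intro s p
      simp only [hLo]
      split_ifs
      · have := abs_le.mp (hre1 p)
        have h0 : 0 ≤ 2 + 2 * (χ (p : ZMod m)).re := by linarith [this.1]
        exact mul_nonneg h0 (Real.rpow_nonneg (Nat.cast_nonneg _) _)
      · exact le_rfl
    -- `Σ Lo = 2 F_U + 2 R_U`
    have hLosum : ∀ s : ℝ, 1 < s → ∑' p, Lo s p =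
        2 * (∑' p : ℕ, if p.Prime ∧ p ∈ U then (p : ℝ) ^ (-s) else 0) +
        2 * (∑' p : ℕ, if p.Prime ∧ p ∈ U then (χ (p : ZMod m)).re * (p : ℝ) ^ (-s) else 0) := by
      intro s hs
      have h1 := LFunctions.PrimeSum.summable U hs
      have h2 := summable_re_mul_indicator χ U hs
      have h3 := (h1.mul_left 2).tsum_add (h2.mul_left 2)
      rw [tsum_mul_left, tsum_mul_left] at h3
      rw [← h3]
      refine tsum_congr fun p ↦ ?_
      by_cases h : p.Prime ∧ p ∈ U
      · simp only [hLo, h, and_self, if_true]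
        ring
      · simp only [hLo, h, if_false]
        ring
    -- `R - #Bad ≤ R_U`
    have hRU : ∀ s : ℝ, 1 < s →
        (∑' p : Nat.Primes, (χ p * (p : ℂ) ^ (-(s : ℂ))).re) - (Bad.ncard : ℝ) ≤
          ∑' p : ℕ, if p.Prime ∧ p ∈ U then (χ (p : ZMod m)).re * (p : ℝ) ^ (-s) else 0 := by
      intro s hs
      rw [tsum_primes_re_eq_tsum_nat]
      have hsplit : (∑' p : ℕ, if p.Prime then (χ (p : ZMod m)).re * (p : ℝ) ^ (-s) else 0) =
          (∑' p : ℕ, if p.Prime ∧ p ∈ U then (χ (p : ZMod m)).re * (p : ℝ) ^ (-s) else 0) +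
          (∑' p : ℕ, if p.Prime ∧ p ∈ Bad then (χ (p : ZMod m)).re * (p : ℝ) ^ (-s) else 0) := by
        rw [← (summable_re_mul_indicator χ U hs).tsum_add (summable_re_mul_indicator χ Bad hs)]
        refine tsum_congr fun p ↦ ?_
        by_cases hp : p.Prime
        · by_cases hpB : p ∈ Bad
          · have hpU : p ∉ U := fun h ↦ ((hUBad p).mp h) hpB
            simp [hp, hpB, hpU]
          · have hpU : p ∈ U := (hUBad p).mpr hpB
            simp [hp, hpB, hpU]
        · simp [hp]
      set g : ℕ → ℝ := fun p ↦
        if p.Prime ∧ p ∈ Bad then (χ (p : ZMod m)).re * (p : ℝ) ^ (-s) else 0 with hgdef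
      have hsn : Summable fun p ↦ ‖g p‖ := by
        have hsa := (summable_re_mul_indicator χ Bad hs).abs
        simpa only [← Real.norm_eq_abs] using hsa
      have hb1 : ‖∑' p, g p‖ ≤ ∑' p, ‖g p‖ := norm_tsum_le_tsum_norm hsn
      have hb2 : ∑' p, ‖g p‖ ≤ ∑' p : ℕ, (if p.Prime ∧ p ∈ Bad then (p : ℝ) ^ (-s) else 0) := by
        refine Summable.tsum_le_tsum (fun p ↦ ?_) hsn (LFunctions.PrimeSum.summable Bad hs)
        simp only [hgdef]
        split_ifs with h
        · rw [Real.norm_eq_abs, abs_mul, abs_of_nonneg (Real.rpow_nonneg (Nat.cast_nonneg _) _)]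
          exact mul_le_of_le_one_left (Real.rpow_nonneg (Nat.cast_nonneg _) _) (hre1 p)
        · simp
      have hb3 : ∑' p : ℕ, (if p.Prime ∧ p ∈ Bad then (p : ℝ) ^ (-s) else 0) ≤ (Bad.ncard : ℝ) :=
        LFunctions.PrimeSum.le_ncard_of_finite Bad hBadfin (by linarith)
      have hb4 : ∑' p, g p ≤ (Bad.ncard : ℝ) := by
        rw [Real.norm_eq_abs] at hb1
        exact (le_abs_self _).trans (hb1.trans (hb2.trans hb3))
      rw [hsplit]
      linarith [hb4]
    -- the lower bound `2 F_U(s) + 2(B - #Bad) ≤ Σ |a_p|² p^{-s}` near `s = 1`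
    have hlow : ∀ᶠ s : ℝ in 𝓝[>] (1 : ℝ),
        2 * (∑' p : ℕ, if p.Prime ∧ p ∈ U then (p : ℝ) ^ (-s) else 0) + 2 * (B - Bad.ncard) ≤
          ∑' p, rankinTerm f s p := by
      filter_upwards [hB, LFunctions.PrimeSum.eventually_one_lt] with s hBs hs1
      have h1 : ∑' p, Lo s p ≤ ∑' p, rankinTerm f s p :=
        Summable.tsum_le_tsum (hLole s) ((hsummf s hs1).of_nonneg_of_le (hLonn s) (hLole s))
          (hsummf s hs1)
      rw [hLosum s hs1] at h1
      have h2 := hRU s hs1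
      linarith
    -- divide by `log (1/(s-1))` and let `s → 1⁺`: `2 ≤ 1`
    have hlim2 : Tendsto (fun s : ℝ ↦
        (2 * (∑' p : ℕ, if p.Prime ∧ p ∈ U then (p : ℝ) ^ (-s) else 0) + 2 * (B - Bad.ncard)) /
          Real.log (1 / (s - 1))) (𝓝[>] (1 : ℝ)) (𝓝 2) := by
      have hU' : Tendsto (fun s : ℝ ↦ (∑' p : ℕ, (if p.Prime ∧ p ∈ U then (p : ℝ) ^ (-s)
          else 0)) / Real.log (1 / (s - 1))) (𝓝[>] (1 : ℝ)) (𝓝 1) := hU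
      have hc : Tendsto (fun s : ℝ ↦ (2 * (B - Bad.ncard)) / Real.log (1 / (s - 1)))
          (𝓝[>] (1 : ℝ)) (𝓝 0) :=
        tendsto_const_nhds.div_atTop LFunctions.PrimeSum.tendsto_log_one_div_sub_one
      have e := (hU'.const_mul 2).add hc
      rw [mul_one, add_zero] at e
      refine e.congr' ?_
      filter_upwards with s
      ring
    have hlim1 : Tendsto (fun s : ℝ ↦ 1 + C / Real.log (1 / (s - 1))) (𝓝[>] (1 : ℝ)) (𝓝 1) := by
      have := (tendsto_const_nhds (x := C)).div_atTop LFunctions.PrimeSum.tendsto_log_one_div_sub_one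
      simpa using this.const_add 1
    have hle : ∀ᶠ s : ℝ in 𝓝[>] (1 : ℝ),
        (2 * (∑' p : ℕ, if p.Prime ∧ p ∈ U then (p : ℝ) ^ (-s) else 0) + 2 * (B - Bad.ncard)) /
          Real.log (1 / (s - 1)) ≤ 1 + C / Real.log (1 / (s - 1)) := by
      filter_upwards [hlow, hC, LFunctions.PrimeSum.eventually_log_pos] with s hlo hCs hlog
      rw [div_le_iff₀ hlog, add_mul, one_mul, div_mul_cancel₀ _ hlog.ne']
      linarith
    have := le_of_tendsto_of_tendsto hlim2 hlim1 hle
    norm_num at this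

/-- **Deligne–Serre 1974, Thm. 4.1 (irreducibility) from the Kronecker–Weber theorem alone**
(the newform facts `f ∈ S_1(N, ε)`, `T_p f = a_p f` being discharged in the tree).
[cite: DeligneSerreASENS1974, Thm. 4.1 and §8.7] -/
theorem thm41_isIrreducible_of_kroneckerWeber' (hKW : KroneckerWeber) :
    thm41_isIrreducible (N := N) :=
  thm41_isIrreducible_of_kroneckerWeber hKW IsNewform1.mem_nebentypusSubspace_nebentypus_holds
    IsNewform1.heckeEigenvalue_eq_coeff_holds

end Irreducible

end Literature.NumberTheory.EllipticCurves.ModularForms.DeligneSerre1974
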